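import Summits.BirchSwinnertonDyer.Rank1Residual.X12.InertBadGoodTwist
import Summits.BirchSwinnertonDyer.Rank1Residual.X12.ClassClosureO10RubinEta
import HarnessLib

/-!
# X12 / O10: the CLASS-CLOSURE sub-partition key `HasSignedLocalType W p T` read as a twist statement
# (companion of `X12/InertBadGoodTwist.lean` on cc-typer-6's node-of-record file `ClassClosureO10RubinEta`)

HONEST FRAMING (cell `b2b-bsdres`, run/shared/lean/b2b/bsd-rank1-residual/, verbatim in every
file): the goal of the cell is to DELETE the COMBINATION-SHAPED residual classes of the
Birch–Swinnerton-Dyer formula for ALL analytic-rank `≤ 1` elliptic curves over `ℚ` — "full BSD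
formula for every rank `≤ 1` curve in class `C`" assembled STRICTLY from published theorems — so
that the rank-`≤ 1` remainder becomes exactly the CONSTRUCTION-SHAPED classes, which are TYPED
(missing-input `Prop`s), NOT attempted. This is not "finishing BSD". Unit `b2b-bsdres-x1b` (X12
prover owner, CLASS-CLOSURE class lead O10/O11/O12), generation 25; research route; X12 REMAINS
CONSTRUCTION-SHAPED; nothing is booked here. Theorems only (two wrappers); no definition, no fact.

For a rank-one CM curve `W/ℚ` of signed local type `(p, T)` at an inert `p ≥ 5`
(`O10.HasSignedLocalType`, cc-typer-6, p253758 — the key on which the class target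
`O10.LowerHalfOnType p T` is indexed): `T = I₀*` ⟹ `W ≅ A^{(p)}` for a globally minimal CM curve `A`
with the same `j` and GOOD (supersingular) reduction at `p` — the partner of the cyclotomic
`η = ω^{(p−1)/2}`-branch frame (HOME `b2b-bsdres-x1b/gen25/O10-O11-ANATOMY-v2.md`); `T ≠ I₀*` ⟹ no
quadratic twist of `W` has good reduction at `p`. Both are gen 25's dichotomy
(`exists_good_partner_of_kodairaSymbolAt_eq_Istar_zero`,
`not_hasGoodReductionAt_twist_of_kodairaSymbolAt_ne_Istar_zero`) composed with
`O10.classX12_of_hasSignedLocalType`.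

References: Silverman *ATAEC* IV.9.4 Step 6, Table 4.1, Ex. 4.49; *AEC* X.5 Prop. 5.4; HOME
`CLASS-CLOSURE-PLAN.md` §3.14, `class-closure/O10/SUBPARTITION-x1b.md`.
-/

noncomputable section

open scoped Classical NumberField

open WeierstrassCurve NumberField IsDedekindDomain IsDedekindDomain.HeightOneSpectrum
  Rat.HeightOneSpectrum Literature.NumberTheory.EllipticCurves
  Literature.NumberTheory.EllipticCurves.Rank1Residual
  Literature.NumberTheory.DiophantineGeometry
  Literature.NumberTheory.DiophantineGeometry.TateAlgorithm

namespace Summit.BirchSwinnertonDyer.Rank1Residual.X12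

variable (W : WeierstrassCurve ℚ) [W.IsElliptic] (p : ℕ) [hp : Fact p.Prime]

/-- **Signed local type `I₀*` ⟹ the good partner exists.** A rank-one CM curve of signed local type
`(p, I₀*)` at an inert prime `p ≥ 5` is `ℚ`-isomorphic to the twist `A^{(p)}` of a globally minimal
curve `A` with `A.j = W.j` and GOOD reduction at the place over `p`.
[cite: SilvermanATAEC1994, IV.9.4 Step 6 and Ex. 4.49] [cite: SilvermanAEC2009, X.5 Prop. 5.4] -/
theorem exists_good_partner_of_hasSignedLocalType_Istar_zero
    (hT : O10.HasSignedLocalType W p (.Istar 0)) (hr : W.analyticRank = 1) (hp5 : 5 ≤ p)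
    (v : HeightOneSpectrum (𝓞 ℚ)) (hv : natGenerator v = p) :
    ∃ (A : WeierstrassCurve ℚ) (_ : A.IsElliptic) (_ : A.IsGloballyMinimal),
      A.HasGoodReductionAt v ∧ A.j = W.j ∧
        ∃ C : VariableChange ℚ, C • A.quadraticTwist (p : ℚ) = W :=
  exists_good_partner_of_kodairaSymbolAt_eq_Istar_zero W p
    (O10.classX12_of_hasSignedLocalType W p hT hr) hp5 hT.2.1 v hv (hT.2.2.2 v hv)

/-- **Signed local type `≠ I₀*` ⟹ no good quadratic twist.** A rank-one CM curve of signed local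
type `(p, T)`, `T ≠ I₀*` (i.e. `T ∈ {II, IV, IV*, II*, III, III*}` by `O10.signedLocalType_cases`;
semistability defect `3, 4` or `6`), at an inert prime `p ≥ 5`: for every `d ∈ ℚ`, `d ≠ 0`, the
twist `W^{(d)}` is BAD at the place over `p`.
[cite: SilvermanATAEC1994, IV.9.4 Step 6 and Table 4.1] [cite: SilvermanAEC2009, X.5 Prop. 5.4] -/
theorem not_hasGoodReductionAt_twist_of_hasSignedLocalType_ne {T : KodairaSymbol}
    (hT : O10.HasSignedLocalType W p T) (hT0 : T ≠ .Istar 0) (hr : W.analyticRank = 1)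
    (hp5 : 5 ≤ p) (v : HeightOneSpectrum (𝓞 ℚ)) (hv : natGenerator v = p) {d : ℚ} (hd : d ≠ 0) :
    ¬ (W.quadraticTwist d).HasGoodReductionAt v :=
  not_hasGoodReductionAt_twist_of_kodairaSymbolAt_ne_Istar_zero W p
    (O10.classX12_of_hasSignedLocalType W p hT hr) hp5 hT.2.1 v hv
    (by rw [hT.2.2.2 v hv]; exact hT0) hd

end Summit.BirchSwinnertonDyer.Rank1Residual.X12

end
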